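import Summits.QuantumFields.Balaban3D.Proofs.AxialGaugeShift
import Summits.QuantumFields.Balaban3D.Proofs.ProductChartSU2

/-!
# `Summit.QuantumFields.Balaban3D.Proofs.AxialGaugeChartSU2` — (13) + (18) for the lane's averaging and `G = SU(2)`: the renormalization
# transform of a gauge-invariant density as an integral over LIE-ALGEBRA-valued fluctuation variables around a background,
# `(Tρ)(V) = ∫ ρ(U′(A)·U₁(V)) Π_b σ(A(b))dA(b)` with `U′(A) = fluct(exp A)` (= 1 on the forest and the crossing bonds, `exp A(b)` on the free bonds)
# — [Balaban1985UV3] p. 260 L18–21 «dU′ = σ(A′)dA′ … σ(A) = 1/2π² (sin|A|/|A|)²» for SU(2), whose exponential chart is GLOBAL up to a null set,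
# so NO support hypothesis is needed for the identity itself (seat p4, lane `pub-balaban3d`; F4+F3+(18) of HOME/drafts/p4/FIBRE49.md)

HONEST FRAMING (lane PLAN.md §0, binding): see `…Proofs.SectAFirstStep`.  [folklore] assembly of `…Proofs.AxialGaugeShift.rnTransport_ae_eq_integral_fluct`
with `…Proofs.ProductChartSU2.integral_fieldMeasure_su2_eq_integral_chart`; nothing of the paper is asserted.
-/

noncomputable section

namespace Summit.QuantumFields.Balaban3D.Proofs.AxialGaugeChartSU2

open _root_.MeasureTheory
open Literature.MathematicalPhysics.QuantumFieldTheory.Balaban1983to89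
open Literature.MathematicalPhysics.QuantumFieldTheory.Balaban1983to89.AveragingRT (axialAvg rnTransport)
open Literature.MathematicalPhysics.QuantumFieldTheory.Balaban1983to89.GaugeField (GaugeInvariant)
open Literature.MathematicalPhysics.QuantumFieldTheory.Balaban1983to89.T4HaarSU2ExpChart (expMeasure)
open Summit.QuantumFields.Balaban3D.Carriers
open Summit.QuantumFields.Balaban3D.Proofs.AxialGauge
open Summit.QuantumFields.Balaban3D.Proofs.AxialGaugeFix
open Summit.QuantumFields.Balaban3D.Proofs.AxialGaugeShift
open Summit.QuantumFields.Balaban3D.Proofs.ProductChartSU2 (SU2 expField measurable_expField integral_fieldMeasure_su2_eq_integral_chart)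

variable {P : Params} {j : ℕ} [DecidableEq (PBond P j)]

/-- The fluctuation field in the chart, `U′(A) := fluct (exp A)` — `1` on the radial forest and on the crossing bonds, `exp(iA(b))` on the free bonds
(the forest/crossing coordinates of `A` are dummy). [cite: Balaban1985UV3, (13) p.259 + (18) p.260] -/
def fluctChart (A : PBond P j → EuclideanSpace ℝ (Fin 3)) : GaugeField P j SU2 := fluct (expField A)

/-- **(13) + (18) FOR SU(2)**: for a measurable, integrable, gauge-invariant density `ρ` on `SU(2)`-valued fields and a background selection `U₁(V)`
in the radial axial gauge with `Ū₁(V) = V` (print (12)), dV-a.e.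
`(Tρ)(V) = ∫ ρ(b ↦ U′(A)(b)·U₁(V)(b)) d(⊗_b expMeasure)(A)`, `expMeasure = (2π²)⁻¹ sinc²‖x‖·𝟙_{‖x‖<π} d³x` = print's `σ(A)dA`.
[cite: Balaban1985UV3, (13) p.259 + (18) p.260] -/
theorem rnTransport_ae_eq_integral_chart (hj : j + 1 ≤ P.m + P.K) (ρ : Density P j SU2) (hρi : Integrable ρ (fieldMeasure P j SU2))
    (hρm : Measurable ρ) (hρinv : GaugeInvariant ρ) (U₁ : GaugeField P (j + 1) SU2 → GaugeField P j SU2)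
    (hax : ∀ V, ∀ b ∈ forest P j, U₁ V b = 1) (hfib : ∀ V, axialAvg (U₁ V) = V) :
    rnTransport (axialAvg : GaugeField P j SU2 → GaugeField P (j + 1) SU2) ρ
      =ᵐ[fieldMeasure P (j + 1) SU2] fun V =>
        ∫ A, ρ (fun b => fluctChart A b * U₁ V b) ∂(Measure.pi fun _ : PBond P j => expMeasure) := by
  refine (rnTransport_ae_eq_integral_fluct hj ρ hρi hρm hρinv U₁ hax hfib).trans (Filter.Eventually.of_forall fun V => ?_)
  -- the integrand `W ↦ ρ(fluct W · U₁ V)` is measurable, hence a.e.-strongly measurable, and the chart applies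
  have hmeas : Measurable fun W : GaugeField P j SU2 => ρ (fun b => fluct W b * U₁ V b) := by
    refine hρm.comp (measurable_pi_iff.mpr fun b => ?_)
    have hfl : Measurable fun W : GaugeField P j SU2 => fluct W b := by
      unfold fluct axGlue
      exact (measurable_pi_apply b).comp ((measurable_crossParam hj).comp
        (measurable_const.prodMk (T4TreeGaugeFixing.measurable_fixTo _ _)))
    exact hfl.mul measurable_const
  exact integral_fieldMeasure_su2_eq_integral_chart _ hmeas.aestronglyMeasurable

end Summit.QuantumFields.Balaban3D.Proofs.AxialGaugeChartSU2

end
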